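import Summits.QuantumFields.BalabanUV.Beta.GAN24.TwoLegChainKing

/-!
# `BalabanUV.Beta.GAN24.TwoLegChainInstances` — binder row G-an2-4 ∕ (CONV-C), route R7, road P2: INSTANCES of the two-leg chain laws
# (`GradientVertexChainKing`, `TwoLegChainKing`) for Bałaban's minimiser at `U = 1`, every torus, constant local vertices:
# `∂H_k ⊗ ∂H_k` (θ = θG(L,½) = L^{−1∕4}), `H_k ⊗ H_k` (θ = L⁻¹, NO exponent loss), `H_k ⊗ ∂H_k` (θ = L^{−1∕4}) — BOTH (CONV-C) CLAUSES each

NOT IN PRINT; OUR PROOF ATTEMPT (unit `b2b-balaban-gan24-p2`, gen 31 = prover-b2b-balaban-gan24-p2-g31-0, road-P2 chair of row G-an2-4;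
CRUX TEAM (2) under the ruling «YM REDIRECT TOWARDS THE SUMMIT», 2026-08-21).  HONEST FRAMING (cell contract, verbatim): «discharging
`BetaPertH` makes Bałaban's UV stability UNCONDITIONAL — a real constructive-QFT result; it is NOT the continuum limit and NOT the Clay
problem.»  HONEST DEPENDENCY (verbatim): «continuum YM on T⁴ ⇐ BetaPertH ∧ nine spine estimates (0/9 proved); BetaPertH ⇐ (D1) ∧ (D4) ∧
CAP+tail; G-an2-4 gates asym, D1 and NE2/3/4.»  ABSOLUTE RULE: nothing printed is a hypothesis; no `def … : Prop`, no `sorry`; [folklore]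
packaging BY NAME of `GradientVertexChainKing.norm_vtxChain_le` ∕ `norm_vtxChain_succ_sub_le_lev`, `TwoLegChainKing.norm_chain2_le` ∕
`norm_chain2_succ_sub_le`, gan24-p3-g27's value laws (`HkKingOneStep.norm_HkOp_bpt_le`, `HkKingOneStepSup.norm_HkOp_par_sub_le`) and this
lineage's gradient law (`HkGradientKingRate.norm_dker_par_sub_le_lev`).  Which of an1's rows T1–T8 a given instance realises is NOT claimed.

## Content (0 sorry)
 * §1 `vtxChain_two_clauses_const` — two GRADIENT legs, constant vertex tensor: `∃ κ C θ<1` with both clauses (θ = L^{−1∕4}).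
 * §2 the legs in the abstract format: `hLeg` (values of `H_k`), `dLeg` (gradients); their block decay at the point and at the parent
   (`norm_hLeg_le`, `norm_hLeg_par_le`, `norm_dLeg_par_le`) and the value leg's parent law `norm_hLeg_sub_le` (p3's `KH1∕N`).
 * §3 **`hh_chain_two_clauses`** (`H_k ⊗ H_k`, θ = L⁻¹) and **`hdh_chain_two_clauses`** (`H_k ⊗ ∂H_k`, θ = θG(L,½)).
HONEST.  [folklore]; U = 1; exponent `L^{−1∕4}` wherever a gradient leg enters (interpolation; idea-1's toy: true sup order η·log(1∕η));
NOT (CONV-C) as a whole, NEVER «G-an2-4 closed», NOT NE2, NOT D1, NOT BetaPertH, NOT continuum, NOT Clay.  Text locations only: [King1986]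
§4 p. 672, p. 664; [Balaban1984PropagatorsI] (1.63) p. 28.
-/

noncomputable section

open scoped BigOperators
open Finset

namespace Summit.QuantumFields.BalabanUV.Beta.GAN24.TwoLegChainInstances

open Literature.MathematicalPhysics.QuantumFieldTheory.Balaban1983to89
open Literature.MathematicalPhysics.QuantumFieldTheory.Balaban1983to89.B5Prop11Plancherel (Tor fine)
open Literature.MathematicalPhysics.QuantumFieldTheory.Balaban1983to89.B4TorusKernel (periodConst)
open Literature.MathematicalPhysics.QuantumFieldTheory.Balaban1983to89.B4TorusKernel.MultiPeriod (torusSupNorm)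
open Literature.MathematicalPhysics.QuantumFieldTheory.Balaban1983to89.B4Sect5Proof (latticeConst latticeConst_nonneg)
open Literature.MathematicalPhysics.QuantumFieldTheory.Balaban1983to89.B5Block118 (bpt)
open Literature.MathematicalPhysics.QuantumFieldTheory.Balaban1983to89.B5Blocks16 (blockOf)
open Literature.MathematicalPhysics.QuantumFieldTheory.Balaban1983to89.B5Kernel166Decay (periodConst_pos)
open Literature.MathematicalPhysics.QuantumFieldTheory.Balaban1983to89.B6LowerBound2153Torus (toT rep toT_rep)
open Literature.MathematicalPhysics.QuantumFieldTheory.Balaban1983to89.B5G183RateUnitTower (lev lev_neZero)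
open Literature.MathematicalPhysics.QuantumFieldTheory.Balaban1983to89.B5Hk163Strip (kappa163 kappa163_pos)
open Literature.MathematicalPhysics.QuantumFieldTheory.Balaban1983to89.B5Hk163Decay (MG163 MG163_nonneg)
open Literature.MathematicalPhysics.QuantumFieldTheory.Balaban1983to89.B5Hk163Torus (HkOp)
open Literature.MathematicalPhysics.QuantumFieldTheory.Balaban1983to89.B5Hk163TorusHolder (dker)
open Literature.MathematicalPhysics.QuantumFieldTheory.Balaban1983to89.B5Hk163TorusHolderDecay (CdecD CdecD_nonneg)
open Literature.MathematicalPhysics.QuantumFieldTheory.Balaban1983to89.Beta.FluctuationProjection (digitOf bpt_blockOf_digitOf)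
open Summit.QuantumFields.BalabanUV.T4Continuum.BalabanAveragedTowerModes (par)
open Summit.QuantumFields.BalabanUV.T4Continuum.BalabanAveragedTowerUnit (cast_lev')
open Summit.QuantumFields.BalabanUV.Beta.GAN24.HkKingOneStep (dec dec_pos KH1 KH1_nonneg norm_HkOp_bpt_le)
open Summit.QuantumFields.BalabanUV.Beta.GAN24.HkKingOneStepSup (parDigit eq_bpt_and_par_eq norm_HkOp_par_sub_le)
open Summit.QuantumFields.BalabanUV.Beta.GAN24.HkGradientKingRate (thetaG thetaG_pos thetaG_lt_one CG CG_nonneg dec_eq norm_dker_par_sub_le_lev)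
open Summit.QuantumFields.BalabanUV.Beta.GAN24.GradientVertexChainKing (VIdx vtxChain norm_dker_le_block norm_vtxChain_le norm_vtxChain_succ_sub_le_lev)
open Summit.QuantumFields.BalabanUV.Beta.GAN24.TwoLegChainKing (Src chain2 norm_chain2_le norm_chain2_succ_sub_le)

variable {d : ℕ}

/-! ## §1 Two gradient legs, constant vertex -/

section Const

variable (L : ℕ) [NeZero L] (M : Fin (d + 1) → ℕ) [hM : ∀ μ, NeZero (M μ)]

/-- **TWO GRADIENT LEGS + A CONSTANT LOCAL VERTEX: BOTH (CONV-C) CLAUSES AT `U = 1` ALONG THE TOWER** (`L ≥ 2`, every torus; `α = ½` so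
`θ = L^{−1∕4}`): for a constant vertex tensor `c` there are `κ > 0`, `C ≥ 0`, `0 ≤ θ < 1` (functions of `d`, `L`, `c`) with, for every `k`, unit
points `y, y′` and components `λ, λ′`:
 (i) `‖K^{(n_k)}[c](y,λ;y′,λ′)‖ ≤ C·e^{−κ|y−y′|_T}`;  (ii) `‖K^{(n_{k+1})}[c](y,λ;y′,λ′) − K^{(n_k)}[c](y,λ;y′,λ′)‖ ≤ C·θ^k·e^{−κ|y−y′|_T}`.
[cite: King1986, §4 p.672 (Leibniz mechanism); Balaban1984PropagatorsI, (1.63) p.28] [folklore] -/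
theorem vtxChain_two_clauses_const (hL : 2 ≤ L) (c : VIdx d → VIdx d → ℂ) :
    ∃ κ C θ : ℝ, 0 < κ ∧ 0 ≤ C ∧ 0 ≤ θ ∧ θ < 1 ∧
      (∀ (k : ℕ) (y y' : Fin (d + 1) → ℤ) (lam lam' : Fin (d + 1)),
        ‖vtxChain (lev L k) M (fun _ => c) (toT M y, lam) (toT M y', lam')‖ ≤ C * Real.exp (-(κ * torusSupNorm M (y - y')))) ∧
      (∀ (k : ℕ) (y y' : Fin (d + 1) → ℤ) (lam lam' : Fin (d + 1)),
        ‖vtxChain (L * lev L k) M (fun _ => c) (toT M y, lam) (toT M y', lam') - vtxChain (lev L k) M (fun _ => c) (toT M y, lam) (toT M y', lam')‖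
          ≤ C * θ ^ k * Real.exp (-(κ * torusSupNorm M (y - y')))) := by
  have hL1 : 1 ≤ L := le_trans (by norm_num) hL
  -- a bound for the constant tensor
  set B : ℝ := ∑ i : VIdx d, ∑ j : VIdx d, ‖c i j‖ with hB
  have hcB : ∀ i j, ‖c i j‖ ≤ B := fun i j => by
    rw [hB]
    exact (Finset.single_le_sum (f := fun j => ‖c i j‖) (fun _ _ => norm_nonneg _) (Finset.mem_univ j)).trans
      (Finset.single_le_sum (f := fun i => ∑ j : VIdx d, ‖c i j‖) (fun _ _ => Finset.sum_nonneg fun _ _ => norm_nonneg _) (Finset.mem_univ i))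
  have hB0 : 0 ≤ B := (norm_nonneg _).trans (hcB (0, 0) (0, 0))
  have hC : 0 ≤ CdecD d := CdecD_nonneg
  have hlc : 0 ≤ latticeConst (d + 1) (dec d / 2) := latticeConst_nonneg _ (half_pos (dec_pos d)).le
  set C1 : ℝ := ((d : ℝ) + 1) ^ 4 * B * CdecD d ^ 2 * latticeConst (d + 1) (dec d / 2)
  set C2 : ℝ := ((d : ℝ) + 1) ^ 4 * (2 * B * CdecD d * CG d (1/2) L) * latticeConst (d + 1) (dec d / 2)
  have hC1 : 0 ≤ C1 := by positivity
  have hC2 : 0 ≤ C2 := by have := CG_nonneg d (1/2) L; positivity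
  refine ⟨dec d / 2, max C1 C2, thetaG L (1/2), half_pos (dec_pos d), le_max_of_le_left hC1, (thetaG_pos hL1 _).le,
    thetaG_lt_one hL (by norm_num), ?_, ?_⟩
  · intro k y y' lam lam'
    exact (norm_vtxChain_le (lev L k) M (fun _ => c) (fun _ i j => hcB i j) y y' lam lam').trans
      (mul_le_mul_of_nonneg_right (le_max_left _ _) (Real.exp_pos _).le)
  · intro k y y' lam lam'
    have h := norm_vtxChain_succ_sub_le_lev L M hL k (fun _ => c) (fun _ => c) (B := B) (εm := 0) (fun _ i j => hcB i j) (fun _ i j => hcB i j)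
      (fun x' i j => by rw [sub_self, norm_zero]) y y' lam lam' (α := 1/2) (by norm_num) (by norm_num)
    refine h.trans ?_
    have hθ : 0 ≤ thetaG L (1/2) ^ k := pow_nonneg (thetaG_pos hL1 _).le k
    have e : ((d : ℝ) + 1) ^ 4 * (2 * B * CdecD d * (CG d (1/2) L * thetaG L (1/2) ^ k) + CdecD d ^ 2 * 0) * latticeConst (d + 1) (dec d / 2)
        = C2 * thetaG L (1/2) ^ k := by ring
    rw [e]
    exact mul_le_mul_of_nonneg_right (mul_le_mul_of_nonneg_right (le_max_right _ _) hθ) (Real.exp_pos _).le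

end Const


/-! ## §2–§3 Value legs, mixed legs -/

section Instances

variable (L : ℕ) [NeZero L] (M : Fin (d + 1) → ℕ) [hM : ∀ μ, NeZero (M μ)]

/-- the VALUE leg of `H_k` in the chain format: `hLeg n x μ (y,λ) := H_n((x,μ),(y,λ))`. [folklore] -/
def hLeg (n : ℕ) [NeZero n] (x : Tor (fine n M)) (μ : Fin (d + 1)) (s : Src M) : ℂ := HkOp n M (x, μ) s

/-- the GRADIENT leg of `H_k` in the chain format: `dLeg n x (μ,ν) (y,λ) := ∂_νH_n((x,μ),(y,λ))`. [folklore] -/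
def dLeg (n : ℕ) [NeZero n] (x : Tor (fine n M)) (i : Fin (d + 1) × Fin (d + 1)) (s : Src M) : ℂ := dker n M i.1 s.2 i.2 x s.1

/-- the value leg decays from its block: `‖H_n((x,μ),(y,λ))‖ ≤ MG163(d+1)·periodConst·e^{−dec|ȳ(x)−y|}` (b05 BY NAME). [folklore] -/
theorem norm_hLeg_le (n : ℕ) [NeZero n] (x : Tor (fine n M)) (μ : Fin (d + 1)) (y : Fin (d + 1) → ℤ) (lam : Fin (d + 1)) :
    ‖hLeg M n x μ (toT M y, lam)‖ ≤ MG163 (d + 1) * periodConst (kappa163 (d + 1)) d * Real.exp (-(dec d * torusSupNorm M (rep M (blockOf n M x) - y))) := by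
  have hx : x = bpt n M (toT M (rep M (blockOf n M x))) (digitOf n M x) := by rw [toT_rep, bpt_blockOf_digitOf]
  have h := norm_HkOp_bpt_le n M μ lam (digitOf n M x) (rep M (blockOf n M x)) y
  rw [← hx] at h
  exact h

/-- the value leg's parent law: `‖H_{RN}((x′,μ),(y,λ)) − H_N((par x′,μ),(y,λ))‖ ≤ KH1(d)∕N·e^{−dec|ȳ(x′)−y|}` (p3's (A2) BY NAME). [folklore] -/
theorem norm_hLeg_sub_le {N R : ℕ} [NeZero N] [NeZero R] (x' : Tor (fine (R * N) M)) (μ : Fin (d + 1)) (y : Fin (d + 1) → ℤ)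
    (lam : Fin (d + 1)) :
    ‖hLeg M (R * N) x' μ (toT M y, lam) - hLeg M N (par N R M x') μ (toT M y, lam)‖
      ≤ KH1 d / N * Real.exp (-(dec d * torusSupNorm M (rep M (blockOf (R * N) M x') - y))) :=
  norm_HkOp_par_sub_le M (x', μ) y lam

/-- the coarse value leg at the parent decays from the CHILD's block (same unit block). [folklore] -/
theorem norm_hLeg_par_le {N R : ℕ} [NeZero N] [NeZero R] (x' : Tor (fine (R * N) M)) (μ : Fin (d + 1)) (y : Fin (d + 1) → ℤ)
    (lam : Fin (d + 1)) :
    ‖hLeg M N (par N R M x') μ (toT M y, lam)‖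
      ≤ MG163 (d + 1) * periodConst (kappa163 (d + 1)) d * Real.exp (-(dec d * torusSupNorm M (rep M (blockOf (R * N) M x') - y))) := by
  obtain ⟨_, hp⟩ := eq_bpt_and_par_eq (N := N) (R := R) M x'
  unfold hLeg
  rw [hp]
  exact norm_HkOp_bpt_le N M μ lam (parDigit M x') (rep M (blockOf (R * N) M x')) y

/-- the coarse gradient leg at the parent decays from the child's block. [folklore] -/
theorem norm_dLeg_par_le (k : ℕ) (x' : Tor (fine (L * lev L k) M)) (i : Fin (d + 1) × Fin (d + 1)) (y : Fin (d + 1) → ℤ)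
    (lam : Fin (d + 1)) :
    ‖dLeg M (lev L k) (par (lev L k) L M x') i (toT M y, lam)‖
      ≤ CdecD d * Real.exp (-(dec d * torusSupNorm M (rep M (blockOf (L * lev L k) M x') - y))) := by
  obtain ⟨_, hp⟩ := eq_bpt_and_par_eq (N := lev L k) (R := L) M x'
  unfold dLeg
  rw [hp]
  have h := B5Hk163TorusHolderDecay.norm_dker_bpt_le (lev L k) M i.1 lam i.2 (parDigit M x') (rep M (blockOf (L * lev L k) M x')) y
  rw [← dec_eq] at h; exact h

/-- **TWO VALUE LEGS `H_k ⊗ H_k` WITH A CONSTANT VERTEX: BOTH (CONV-C) CLAUSES AT `U = 1`**, every torus, rate `(L⁻¹)^k` (NO exponent loss —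
the value legs' parent law is p3-g27's `KH1∕N`). [cite: King1986, §4 p.672; Balaban1984PropagatorsI, (1.63) p.28] [folklore] -/
theorem hh_chain_two_clauses (hL : 2 ≤ L) (c : Fin (d + 1) → Fin (d + 1) → ℂ) :
    ∃ κ C θ : ℝ, 0 < κ ∧ 0 ≤ C ∧ 0 ≤ θ ∧ θ < 1 ∧
      (∀ (k : ℕ) (y y' : Fin (d + 1) → ℤ) (lam lam' : Fin (d + 1)),
        ‖chain2 (lev L k) M (hLeg M (lev L k)) (hLeg M (lev L k)) (fun _ => c) (toT M y, lam) (toT M y', lam')‖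
          ≤ C * Real.exp (-(κ * torusSupNorm M (y - y')))) ∧
      (∀ (k : ℕ) (y y' : Fin (d + 1) → ℤ) (lam lam' : Fin (d + 1)),
        ‖chain2 (L * lev L k) M (hLeg M (L * lev L k)) (hLeg M (L * lev L k)) (fun _ => c) (toT M y, lam) (toT M y', lam')
            - chain2 (lev L k) M (hLeg M (lev L k)) (hLeg M (lev L k)) (fun _ => c) (toT M y, lam) (toT M y', lam')‖
          ≤ C * ((L : ℝ)⁻¹) ^ k * Real.exp (-(κ * torusSupNorm M (y - y')))) := by
  have hL1 : 1 ≤ L := le_trans (by norm_num) hL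
  have hL0 : (0 : ℝ) < L := by exact_mod_cast hL1
  set B : ℝ := ∑ i : Fin (d + 1), ∑ j : Fin (d + 1), ‖c i j‖ with hB
  have hcB : ∀ i j, ‖c i j‖ ≤ B := fun i j => by
    rw [hB]
    exact (Finset.single_le_sum (f := fun j => ‖c i j‖) (fun _ _ => norm_nonneg _) (Finset.mem_univ j)).trans
      (Finset.single_le_sum (f := fun i => ∑ j : Fin (d + 1), ‖c i j‖) (fun _ _ => Finset.sum_nonneg fun _ _ => norm_nonneg _) (Finset.mem_univ i))
  have hB0 : 0 ≤ B := (norm_nonneg _).trans (hcB 0 0)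
  set CP : ℝ := MG163 (d + 1) * periodConst (kappa163 (d + 1)) d with hCP
  have hCP0 : 0 ≤ CP := mul_nonneg (MG163_nonneg _) (periodConst_pos (kappa163_pos _) d).le
  have hK1 := KH1_nonneg d
  have hlc : 0 ≤ latticeConst (d + 1) (dec d / 2) := latticeConst_nonneg _ (half_pos (dec_pos d)).le
  set C1 : ℝ := ((d : ℝ) + 1) * ((d : ℝ) + 1) * B * CP * CP * latticeConst (d + 1) (dec d / 2)
  set C2 : ℝ := ((d : ℝ) + 1) * ((d : ℝ) + 1) * (KH1 d * B * CP + CP * 0 * CP + CP * B * KH1 d) * latticeConst (d + 1) (dec d / 2)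
  have hC1 : 0 ≤ C1 := by positivity
  have hC2 : 0 ≤ C2 := by positivity
  have hcard : (Fintype.card (Fin (d + 1)) : ℝ) = (d : ℝ) + 1 := by simp
  refine ⟨dec d / 2, max C1 C2, (L : ℝ)⁻¹, half_pos (dec_pos d), le_max_of_le_left hC1, inv_nonneg.mpr hL0.le,
    inv_lt_one_of_one_lt₀ (by exact_mod_cast hL), ?_, ?_⟩
  · intro k y y' lam lam'
    have h := norm_chain2_le (lev L k) M (hLeg M (lev L k)) (hLeg M (lev L k)) (fun _ => c) (δ := dec d) (dec_pos d) hB0 hCP0 hCP0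
      (fun _ i j => hcB i j) (fun x i w l => norm_hLeg_le M (lev L k) x i w l) (fun x j w l => norm_hLeg_le M (lev L k) x j w l) y y' lam lam'
    rw [hcard] at h
    exact h.trans (mul_le_mul_of_nonneg_right (le_max_left _ _) (Real.exp_pos _).le)
  · intro k y y' lam lam'
    have hρ : 0 ≤ KH1 d / (lev L k : ℕ) := div_nonneg hK1 (Nat.cast_nonneg _)
    have h := norm_chain2_succ_sub_le M (hLeg M (L * lev L k)) (hLeg M (lev L k)) (hLeg M (L * lev L k)) (hLeg M (lev L k))
      (fun _ => c) (fun _ => c) (δ := dec d) (dec_pos d) hB0 hCP0 hCP0 hρ hρ le_rfl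
      (fun _ i j => hcB i j) (fun _ i j => hcB i j) (fun x' i j => by rw [sub_self, norm_zero])
      (fun x' i w l => norm_hLeg_par_le M x' i w l) (fun x' j w l => norm_hLeg_le M (L * lev L k) x' j w l)
      (fun x' i w l => norm_hLeg_sub_le M x' i w l) (fun x' j w l => norm_hLeg_sub_le M x' j w l) y y' lam lam'
    rw [hcard, cast_lev', div_eq_mul_inv, ← inv_pow] at h
    refine h.trans ?_
    have hθ : 0 ≤ ((L : ℝ)⁻¹) ^ k := pow_nonneg (inv_nonneg.mpr hL0.le) k
    have e : ((d : ℝ) + 1) * ((d : ℝ) + 1) * (KH1 d * ((L : ℝ)⁻¹) ^ k * B * CP + CP * 0 * CP + CP * B * (KH1 d * ((L : ℝ)⁻¹) ^ k))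
          * latticeConst (d + 1) (dec d / 2) = C2 * ((L : ℝ)⁻¹) ^ k := by ring
    rw [e]
    exact mul_le_mul_of_nonneg_right (mul_le_mul_of_nonneg_right (le_max_right _ _) hθ) (Real.exp_pos _).le

/-- **A VALUE LEG AND A GRADIENT LEG `H_k ⊗ ∂H_k` WITH A CONSTANT VERTEX: BOTH (CONV-C) CLAUSES AT `U = 1`**, every torus, rate
`θG(L,½)^k = L^{−k∕4}` (the gradient leg's interpolated exponent dominates). [cite: King1986, §4 p.672; Balaban1984PropagatorsI, (1.63) p.28] [folklore] -/
theorem hdh_chain_two_clauses (hL : 2 ≤ L) (c : Fin (d + 1) → (Fin (d + 1) × Fin (d + 1)) → ℂ) :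
    ∃ κ C θ : ℝ, 0 < κ ∧ 0 ≤ C ∧ 0 ≤ θ ∧ θ < 1 ∧
      (∀ (k : ℕ) (y y' : Fin (d + 1) → ℤ) (lam lam' : Fin (d + 1)),
        ‖chain2 (lev L k) M (hLeg M (lev L k)) (dLeg M (lev L k)) (fun _ => c) (toT M y, lam) (toT M y', lam')‖
          ≤ C * Real.exp (-(κ * torusSupNorm M (y - y')))) ∧
      (∀ (k : ℕ) (y y' : Fin (d + 1) → ℤ) (lam lam' : Fin (d + 1)),
        ‖chain2 (L * lev L k) M (hLeg M (L * lev L k)) (dLeg M (L * lev L k)) (fun _ => c) (toT M y, lam) (toT M y', lam')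
            - chain2 (lev L k) M (hLeg M (lev L k)) (dLeg M (lev L k)) (fun _ => c) (toT M y, lam) (toT M y', lam')‖
          ≤ C * thetaG L (1/2) ^ k * Real.exp (-(κ * torusSupNorm M (y - y')))) := by
  have hL1 : 1 ≤ L := le_trans (by norm_num) hL
  have hL0 : (0 : ℝ) < L := by exact_mod_cast hL1
  set B : ℝ := ∑ i : Fin (d + 1), ∑ j : Fin (d + 1) × Fin (d + 1), ‖c i j‖ with hB
  have hcB : ∀ i j, ‖c i j‖ ≤ B := fun i j => by
    rw [hB]
    exact (Finset.single_le_sum (f := fun j => ‖c i j‖) (fun _ _ => norm_nonneg _) (Finset.mem_univ j)).trans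
      (Finset.single_le_sum (f := fun i => ∑ j : Fin (d + 1) × Fin (d + 1), ‖c i j‖) (fun _ _ => Finset.sum_nonneg fun _ _ => norm_nonneg _)
        (Finset.mem_univ i))
  have hB0 : 0 ≤ B := (norm_nonneg _).trans (hcB 0 (0, 0))
  set CP : ℝ := MG163 (d + 1) * periodConst (kappa163 (d + 1)) d with hCP
  have hCP0 : 0 ≤ CP := mul_nonneg (MG163_nonneg _) (periodConst_pos (kappa163_pos _) d).le
  have hCQ0 : 0 ≤ CdecD d := CdecD_nonneg
  have hK1 := KH1_nonneg d
  have hCG := CG_nonneg d (1/2) L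
  have hlc : 0 ≤ latticeConst (d + 1) (dec d / 2) := latticeConst_nonneg _ (half_pos (dec_pos d)).le
  have hcardι : (Fintype.card (Fin (d + 1)) : ℝ) = (d : ℝ) + 1 := by simp
  have hcardκ : (Fintype.card (Fin (d + 1) × Fin (d + 1)) : ℝ) = ((d : ℝ) + 1) * ((d : ℝ) + 1) := by simp
  set C1 : ℝ := ((d : ℝ) + 1) * (((d : ℝ) + 1) * ((d : ℝ) + 1)) * B * CP * CdecD d * latticeConst (d + 1) (dec d / 2)
  set C2 : ℝ := ((d : ℝ) + 1) * (((d : ℝ) + 1) * ((d : ℝ) + 1)) * (KH1 d * L * B * CdecD d + CP * B * CG d (1/2) L) * latticeConst (d + 1) (dec d / 2)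
  have hC1 : 0 ≤ C1 := by positivity
  have hC2 : 0 ≤ C2 := by positivity
  refine ⟨dec d / 2, max C1 C2, thetaG L (1/2), half_pos (dec_pos d), le_max_of_le_left hC1, (thetaG_pos hL1 _).le,
    thetaG_lt_one hL (by norm_num), ?_, ?_⟩
  · intro k y y' lam lam'
    have h := norm_chain2_le (lev L k) M (hLeg M (lev L k)) (dLeg M (lev L k)) (fun _ => c) (δ := dec d) (dec_pos d) hB0 hCP0 hCQ0
      (fun _ i j => hcB i j) (fun x i w l => norm_hLeg_le M (lev L k) x i w l) (fun x j w l => norm_dker_le_block (lev L k) M j.1 l j.2 x w)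
      y y' lam lam'
    rw [hcardι, hcardκ] at h
    exact h.trans (mul_le_mul_of_nonneg_right (le_max_left _ _) (Real.exp_pos _).le)
  · intro k y y' lam lam'
    have hθk : 0 ≤ thetaG L (1/2) ^ k := pow_nonneg (thetaG_pos hL1 _).le k
    -- the value leg's rate `KH1/n_k = KH1·(L⁻¹)^k ≤ KH1·L·θG^k`
    have hrate : KH1 d / ((lev L k : ℕ) : ℝ) ≤ KH1 d * L * thetaG L (1/2) ^ k := by
      rw [div_eq_mul_inv, mul_assoc]
      refine mul_le_mul_of_nonneg_left ?_ hK1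
      -- (lev L k)⁻¹ = (L⁻¹)^k ≤ θG^k ≤ L·θG^k
      rw [cast_lev', ← inv_pow]
      have hL1' : (1 : ℝ) ≤ L := by exact_mod_cast hL1
      have hx0 : 0 < ((L : ℝ)⁻¹) := inv_pos.mpr hL0
      have hx1 : ((L : ℝ)⁻¹) ≤ 1 := inv_le_one_of_one_le₀ hL1'
      have h2 : ((L : ℝ)⁻¹) ^ k ≤ thetaG L (1/2) ^ k := by
        refine pow_le_pow_left₀ hx0.le ?_ k
        unfold thetaG
        conv_lhs => rw [← Real.rpow_one ((L : ℝ)⁻¹)]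
        exact Real.rpow_le_rpow_of_exponent_ge hx0 hx1 (by norm_num)
      calc ((L : ℝ)⁻¹) ^ k ≤ thetaG L (1/2) ^ k := h2
        _ = 1 * thetaG L (1/2) ^ k := (one_mul _).symm
        _ ≤ L * thetaG L (1/2) ^ k := mul_le_mul_of_nonneg_right hL1' hθk
    have hρP : 0 ≤ KH1 d * L * thetaG L (1/2) ^ k := by positivity
    have hρQ : 0 ≤ CG d (1/2) L * thetaG L (1/2) ^ k := by positivity
    have h := norm_chain2_succ_sub_le M (hLeg M (L * lev L k)) (hLeg M (lev L k)) (dLeg M (L * lev L k)) (dLeg M (lev L k))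
      (fun _ => c) (fun _ => c) (δ := dec d) (dec_pos d) hB0 hCP0 hCQ0 hρP hρQ le_rfl
      (fun _ i j => hcB i j) (fun _ i j => hcB i j) (fun x' i j => by rw [sub_self, norm_zero])
      (fun x' i w l => norm_hLeg_par_le M x' i w l) (fun x' j w l => norm_dker_le_block (L * lev L k) M j.1 l j.2 x' w)
      (fun x' i w l => (norm_hLeg_sub_le M x' i w l).trans (mul_le_mul_of_nonneg_right hrate (Real.exp_pos _).le))
      (fun x' j w l => norm_dker_par_sub_le_lev L M hL k (x', j.1) j.2 l w (α := 1/2) (by norm_num) (by norm_num)) y y' lam lam'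
    rw [hcardι, hcardκ] at h
    refine h.trans ?_
    have e : ((d : ℝ) + 1) * (((d : ℝ) + 1) * ((d : ℝ) + 1)) *
          (KH1 d * L * thetaG L (1/2) ^ k * B * CdecD d + CP * 0 * CdecD d + CP * B * (CG d (1/2) L * thetaG L (1/2) ^ k))
          * latticeConst (d + 1) (dec d / 2) = C2 * thetaG L (1/2) ^ k := by ring
    rw [e]
    exact mul_le_mul_of_nonneg_right (mul_le_mul_of_nonneg_right (le_max_right _ _) hθk) (Real.exp_pos _).le

end Instances


end Summit.QuantumFields.BalabanUV.Beta.GAN24.TwoLegChainInstances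

end
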